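import Summits.ResolutionOfSingularities.ResolutionOfSingularities.Theorems.EquisingularLiftEquisingularLiftNatTowerInvDefs
import Literature.AlgebraicGeometry.Resolution.EffectiveCartierStalks
import Literature.AlgebraicGeometry.Resolution.BlowupChartMembership
import Literature.AlgebraicGeometry.Resolution.AlterationsSectionDivisor
import Literature.AlgebraicGeometry.Resolution.KollarBlowupSequenceFunctors
import Literature.AlgebraicGeometry.Resolution.StalkIdealLemmas
import Literature.AlgebraicGeometry.Resolution.MarkedIdealsLemmas
import Literature.AlgebraicGeometry.Resolution.RegularLocalRings
import HarnessLib

/-!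
# [OURS · L1 W4.5(b) · EL♮(3)] (k-v) ⇒ (k-vi): if `E` cuts a Cartier divisor on the cone, the cone cuts a Cartier divisor on `E`
# (tower assembly HSUB′(ReachTower₂)₃ — creation of the clause (k-vi) of `Tower.Shadow₂`, …NatTowerInvDefs v2)

res-D-pv-029 g8 (HSUB′(ReachTower)₃ ASSEMBLY). OURS; NOT a statement of any manuscript; AI-written, weaker than expert review. No `sorry`;
standard axioms. DEF-FREE. `--supports stmt-ResolutionOfSingularities-20148 --as helper`.

WHAT. `isEffectiveCartier_comap_subschemeι_swap`: on an integral locally Noetherian `X`, let `𝓔`, `𝒦` be LOCALLY PRINCIPAL ideal sheaves with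
`V(𝓔)` REGULAR and `𝒦 ≠ ⊥`. If `𝓔|_{V(𝒦)}` is an effective Cartier divisor (res-D-pv-051's `hE𝒦`, clause (k-v)), then `𝒦|_{V(𝓔)}` is an
effective Cartier divisor (`hK𝓔`, clause (k-vi)). ALGEBRA at a point `z ∈ V(𝓔) ∩ V(𝒦)`: `𝓔_z = (e)`, `𝒦_z = (κ)`; `𝒪_{V(𝓔),z} = 𝒪_{X,z}/(e)`
is a regular local ring, hence a domain, so `κ̄` is a non-zero-divisor unless `κ ∈ (e)`; but `κ = eκ′` and «`e` is a non-zero-divisor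
mod `κ`» give `κ′ ∈ (κ)`, `κ′ = eκ′c`, `κ′ = 0` (`1 − ec` is a unit), `κ = 0` — impossible on an integral scheme with `𝒦 ≠ ⊥`
(Literature `stalkIdeal_ne_bot_of_ne_bot`). Assembled with Literature `isEffectiveCartier_of_forall_mem_nonZeroDivisors` (Stacks 01WS).
-/

set_option linter.dupNamespace false -- mandated namespace `Summit.<Summit>.<Problem>` of this single-conjunct summit

noncomputable section

open CategoryTheory AlgebraicGeometry TopologicalSpace IsLocalRing
open Literature.AlgebraicGeometry.Resolution
open AlgebraicGeometry.Scheme.IdealSheafData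

namespace Summit.ResolutionOfSingularities.ResolutionOfSingularities.Cruxes.EquisingularLiftNat.Sections

universe u

/-- Ring lemma: in a local ring, if `e ∈ 𝔪` is a non-zero-divisor modulo `(κ)` (`e·x ∈ (κ) → x ∈ (κ)`) and `κ ∈ (e)`, then `κ = 0`.
[folklore] -/
theorem eq_zero_of_mem_span_of_regular_mod {R : Type u} [CommRing R] [IsLocalRing R] {e κ : R} (he : e ∈ maximalIdeal R)
    (hreg : ∀ x : R, e * x ∈ Ideal.span {κ} → x ∈ Ideal.span {κ}) (hκ : κ ∈ Ideal.span {e}) : κ = 0 := by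
  obtain ⟨κ', rfl⟩ := Ideal.mem_span_singleton'.mp hκ
  have h1 : κ' ∈ Ideal.span {κ' * e} := hreg κ' (by rw [mul_comm]; exact Ideal.mem_span_singleton_self _)
  obtain ⟨c, hc⟩ := Ideal.mem_span_singleton'.mp h1
  have h2 : κ' * (1 - c * e) = 0 := by linear_combination (-1 : R) * hc
  have hu : IsUnit (1 - c * e) :=
    IsLocalRing.isUnit_one_sub_self_of_mem_nonunits _ (Ideal.mul_mem_left _ c he)
  have : κ' = 0 := (hu.mul_left_eq_zero).mp h2
  rw [this, zero_mul]

/-- If `𝓔|_{V(𝒦)}` is an effective Cartier divisor, then at every point `p` of `V(𝒦)` a generator `e` of `𝓔_p` is a non-zero-divisor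
modulo a generator `κ` of `𝒦_p`: `e·x ∈ (κ) → x ∈ (κ)`. [folklore] -/
theorem regular_mod_of_isEffectiveCartier_comap {X : Scheme.{u}} (𝓔 𝒦 : X.IdealSheafData)
    (hE𝒦 : IsEffectiveCartier (𝓔.comap 𝒦.subschemeι)) (p : X) (hp : p ∈ (𝒦.support : Set X))
    (e κ : X.presheaf.stalk p) (he : stalkIdeal 𝓔 p = Ideal.span {e}) (hκ : stalkIdeal 𝒦 p = Ideal.span {κ}) :
    ∀ x : X.presheaf.stalk p, e * x ∈ Ideal.span {κ} → x ∈ Ideal.span {κ} := by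
  obtain ⟨s', rfl⟩ : ∃ s' : 𝒦.subscheme, 𝒦.subschemeι s' = p := by
    have : p ∈ Set.range 𝒦.subschemeι := by rw [Scheme.IdealSheafData.range_subschemeι]; exact hp
    exact this
  set φ := (𝒦.subschemeι.stalkMap s').hom with hφ
  obtain ⟨t, ht, hts⟩ := hE𝒦.exists_stalkIdeal_eq_span s'
  have hte : Ideal.span {t} = Ideal.span {φ e} := by
    rw [← hts, stalkIdeal_comap_eq_map_stalkMap, he, Ideal.map_span, Set.image_singleton]
  -- `φ e` is a non-zero-divisor (a unit multiple of `t`)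
  have hendz : φ e ∈ nonZeroDivisors _ := by
    obtain ⟨a, ha⟩ := Ideal.mem_span_singleton'.mp (show t ∈ Ideal.span {φ e} from hte ▸ Ideal.mem_span_singleton_self t)
    obtain ⟨b, hb⟩ := Ideal.mem_span_singleton'.mp (show φ e ∈ Ideal.span {t} from hte.symm ▸ Ideal.mem_span_singleton_self _)
    have h1 : t * (1 - a * b) = 0 := by
      have h : a * (b * t) = t := by rw [hb]; exact ha
      linear_combination (-1 : 𝒦.subscheme.presheaf.stalk s') * h
    have hab : 1 - a * b = 0 := (mem_nonZeroDivisors_iff.mp ht).1 _ h1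
    have hbu : IsUnit b := isUnit_iff_exists_inv.mpr ⟨a, by linear_combination (-1 : 𝒦.subscheme.presheaf.stalk s') * hab⟩
    rw [← hb]
    exact mul_mem_nonZeroDivisors.mpr ⟨hbu.mem_nonZeroDivisors, ht⟩
  -- `ker φ = (κ)`
  have hker : RingHom.ker φ = Ideal.span {κ} := by
    have hk := stalkIdeal_ker_eq_ker_stalkMap 𝒦.subschemeι s'
    rw [Scheme.IdealSheafData.ker_subschemeι] at hk
    rw [hφ, ← hk, hκ]
  intro x hx
  have hx0 : φ (e * x) = 0 := by rw [← RingHom.mem_ker, hker]; exact hx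
  rw [map_mul] at hx0
  have : φ x = 0 := (mem_nonZeroDivisors_iff.mp hendz).1 _ hx0
  rw [← hker]; exact this

/-- **(k-v) ⇒ (k-vi).** See the module docstring. [cite: StacksProject, Tag 01WS] [OURS · L1 W4.5b] -/
theorem isEffectiveCartier_comap_subschemeι_swap {X : Scheme.{u}} [IsIntegral X] [IsLocallyNoetherian X]
    (𝓔 𝒦 : X.IdealSheafData) (h𝓔p : ∀ z : X, (stalkIdeal 𝓔 z).IsPrincipal) (h𝒦p : ∀ z : X, (stalkIdeal 𝒦 z).IsPrincipal)
    (h𝓔reg : Scheme.IsRegular 𝓔.subscheme) (h𝒦0 : 𝒦 ≠ ⊥) (hE𝒦 : IsEffectiveCartier (𝓔.comap 𝒦.subschemeι)) :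
    IsEffectiveCartier (𝒦.comap 𝓔.subschemeι) := by
  classical
  haveI : IsLocallyNoetherian 𝓔.subscheme := LocallyOfFiniteType.isLocallyNoetherian 𝓔.subschemeι
  refine isEffectiveCartier_of_forall_mem_nonZeroDivisors fun s hs => ?_
  -- generators of the two stalks at `ι s`
  obtain ⟨e, he⟩ := (h𝓔p (𝓔.subschemeι s)).principal
  obtain ⟨κ, hκ⟩ := (h𝒦p (𝓔.subschemeι s)).principal
  have he' : stalkIdeal 𝓔 (𝓔.subschemeι s) = Ideal.span {e} := by rw [he, Ideal.submodule_span_eq]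
  have hκ' : stalkIdeal 𝒦 (𝓔.subschemeι s) = Ideal.span {κ} := by rw [hκ, Ideal.submodule_span_eq]
  have hz𝓔 : 𝓔.subschemeι s ∈ (𝓔.support : Set X) := by
    rw [← Scheme.IdealSheafData.range_subschemeι]; exact ⟨s, rfl⟩
  have hz𝒦 : 𝓔.subschemeι s ∈ (𝒦.support : Set X) := by
    have h1 : s ∈ ((𝒦.comap 𝓔.subschemeι).support : Set _) := hs
    rw [Scheme.IdealSheafData.support_comap] at h1
    exact h1
  have he𝔪 : e ∈ maximalIdeal (X.presheaf.stalk (𝓔.subschemeι s)) := by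
    have h := (mem_support_iff_stalkIdeal_le 𝓔 (𝓔.subschemeι s)).mp hz𝓔
    rw [he'] at h
    exact h (Ideal.mem_span_singleton_self e)
  -- the stalk of the restricted cone is `(ι^♯ κ)`
  have hst : stalkIdeal (𝒦.comap 𝓔.subschemeι) s = Ideal.span {(𝓔.subschemeι.stalkMap s).hom κ} := by
    rw [stalkIdeal_comap_eq_map_stalkMap, hκ', Ideal.map_span, Set.image_singleton]
  refine ⟨(𝓔.subschemeι.stalkMap s).hom κ, ?_, hst⟩
  -- `𝒪_{V(𝓔),s}` is a regular local ring, hence a domain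
  haveI : IsRegularLocalRing (𝓔.subscheme.presheaf.stalk s) := h𝓔reg s
  haveI : IsDomain (𝓔.subscheme.presheaf.stalk s) := isDomain_of_isRegularLocalRing _
  refine mem_nonZeroDivisors_of_ne_zero fun h0 => ?_
  -- then `κ ∈ ker ι^♯_s = 𝓔_{ι s} = (e)`
  have hker : κ ∈ Ideal.span {e} := by
    have hk := stalkIdeal_ker_eq_ker_stalkMap 𝓔.subschemeι s
    rw [Scheme.IdealSheafData.ker_subschemeι] at hk
    rw [← he', hk]
    exact h0
  have hreg := regular_mod_of_isEffectiveCartier_comap 𝓔 𝒦 hE𝒦 (𝓔.subschemeι s) hz𝒦 e κ he' hκ'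
  have hκ0 : κ = 0 := eq_zero_of_mem_span_of_regular_mod he𝔪 hreg hker
  apply stalkIdeal_ne_bot_of_ne_bot h𝒦0 (𝓔.subschemeι s)
  rw [hκ', hκ0, Ideal.span_singleton_eq_bot]

end Summit.ResolutionOfSingularities.ResolutionOfSingularities.Cruxes.EquisingularLiftNat.Sections

end
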